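import Summits.NavierStokesRegularity.NavierStokesRegularity.Theorems.ScenarioCensusDeviatorMeterEngine
import Summits.NavierStokesRegularity.NavierStokesRegularity.Theorems.ScenarioCensusRoughnessMeter
import Summits.NavierStokesRegularity.NavierStokesRegularity.Theorems.ScenarioCensusDiffusionMeterRows
import HarnessLib

/-!
# LINE «deviator-meter» port, part 4/4: §H the rows, §I proofs of the decided rows, §J nestings and controls; census KEYS `Row_A2da` / `Row_A2d1` / `Row_A2d0` / `Row_A2db` /
# `Row_A2dv` + `_excluded`, `Row_A2dn` / `Row_A2dl` (OPEN)

Re-homed for the scenario census (typer seat ns-census-typer-1 g8; cells of ns-idea-2 g14 LINE g14-4 «deviator-meter», rev 2 528544c56f6257b6 = rev 1 + one nesting (ref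
ns-census-ref §15.23 / §15.27 ✓, critic idea-crit-3 PASS — no price), members of block A2 booked by the lead since census v1.79 / v1.80; this port makes the decided cells
TREE-decided): VERBATIM PORT of `pub/ideators/ns-idea-2/lines/deviator-meter/line-deviator-meter.rev2.lean` sha16 528544c56f6257b6 (1325 l., lean check rc 0, 0 sorry), split
for the 400-line rule into `ScenarioCensusDeviatorMeter` (§A–§C) → `…DeviatorMeterStress` (§D–§E) → `…DeviatorMeterEngine` (§F–§G) → `…DeviatorMeterRows` (§H–§J + census
KEYS).  Lean text VERBATIM in namespace `…Theorems.ScenarioCensus.DeviatorMeter` (the line's `…Lines.DeviatorMeter` re-homed); port edits: `local notation "E3"` →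
`abbrev E3` (typer lint: no notation in port files), `@[conjecture]` on the OPEN rows `Row_A2dn` / `Row_A2dl` (typed only), one-line docstrings added where missing (gate lint);
lemmas and the constant `kernelConst` that the line shares VERBATIM with the landed roughness-meter / diffusion-meter ports are taken BY NAME (listed below).  Statements
untouched.

No census VALUE is moved here (the cells become TREE-decided by name; booking is the lead's); NS regularity is NOT proved; (L′) ⟨10661⟩ is untouched; no summit
statement is proved by this file. Lemmas that restate already-landed tree declarations are taken BY NAME (gate lint `dedup.landed`): `kernelConst` = `RoughnessMeter.kernelConst`, `kernelConst_pos` = `RoughnessMeter.kernelConst_pos`, `kernelConst_spec` = `RoughnessMeter.kernelConst_spec`, `integrableOn_sub_rpow` = `RoughnessMeter.integrableOn_sub_rpow`, `setIntegral_sub_rpow` = `RoughnessMeter.setIntegral_sub_rpow`, `eq_zero_of_small_backward_end` = `DiffusionMeter.eq_zero_of_small_backward_end`.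
-/

-- the summit and its single problem share the name `NavierStokesRegularity` (D-0017 nested layout)
set_option linter.dupNamespace false

noncomputable section

open Set Function Filter Topology Metric MeasureTheory
open scoped RealInnerProductSpace

namespace Summit.NavierStokesRegularity.NavierStokesRegularity.Theorems.ScenarioCensus.DeviatorMeter

open Literature.Analysis Literature.Analysis.FluidPDE
open Summit.NavierStokesRegularity.NavierStokesRegularity.Theorems.SimilarityEnstrophy
  (typeI_ancient_eq_zero_of_rate_lt_one)
open Summit.NavierStokesRegularity.NavierStokesRegularity.Theorems.SymmetryModuliCountSymmetricLiouville
  (vanishes_of_vanishes_before)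

/-! ## H. The rows (census A-block cells, (L′)-shape over `IsTypeIAncientMild C u` BY NAME) -/

/-- **Row A2da (ISOTROPY ABOVE A RELATIVE SCALE; engine row, PROVED, mixed thresholds).**
There is a universal `δ₀ > 0` and, for every constant `C`, a relative scale `θ₀(C) > 0` such
that: a Type-I ancient mild field `u ∈ A_C` whose Reynolds stress, coarse-grained at any heat
scale `s ≥ θ(-t)` (`0 < θ ≤ θ₀(C)`), is `δ₀`-ISOTROPIC in the scale-invariant sense
`|e^{sΔ}(u⊗u - ⅓|u|²I)(t,y)ⱼₖ| ≤ δ₀/(-t)`, vanishes identically.  NO smallness of `u`, of its heat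
averages, or of `|u|²` is assumed: the isotropic part of the stress (the "turbulent pressure") may
carry the full Type-I size `C²/(-t)`. -/
def Row_A2da : Prop :=
  ∃ δ₀ : ℝ, 0 < δ₀ ∧ ∀ C : ℝ, ∃ θ₀ : ℝ, 0 < θ₀ ∧ ∀ θ : ℝ, 0 < θ → θ ≤ θ₀ →
    ∀ u : ℝ → E3 → E3, IsTypeIAncientMild C u →
      (∀ t < 0, ∀ s : ℝ, θ * (-t) ≤ s → ∀ y j k, |devStress u t s j k y| ≤ δ₀ / (-t)) →
        ∀ t < 0, ∀ x, u t x = 0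

/-- **Row A2d1 (SINGLE-SCALE ISOTROPY; PROVED, mixed thresholds — the head of the decided part).**
Same thresholds; the hypothesis is imposed at ONE coarse-graining scale per time, `s = θ(-t)`:
`|e^{θ(-t)Δ}(u⊗u - ⅓|u|²I)(t,y)ⱼₖ| ≤ δ₀/(-t)` for all `t < 0`, `y`, `j`, `k` ⇒ `u ≡ 0`.
(Semigroup covariance of the meter upgrades one scale to all larger scales.)  Reading: a
singularity model must carry an ANISOTROPIC coarse-grained momentum flux, of scale-invariant size
`≥ δ₀`, at the single relative scale `θ(C)`, at some point, at every time. -/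
def Row_A2d1 : Prop :=
  ∃ δ₀ : ℝ, 0 < δ₀ ∧ ∀ C : ℝ, ∃ θ₀ : ℝ, 0 < θ₀ ∧ ∀ θ : ℝ, 0 < θ → θ ≤ θ₀ →
    ∀ u : ℝ → E3 → E3, IsTypeIAncientMild C u →
      (∀ t < 0, ∀ y j k, |devStress u t (θ * (-t)) j k y| ≤ δ₀ / (-t)) →
        ∀ t < 0, ∀ x, u t x = 0

/-- **Row A2d0 (THE EXACTLY ISOTROPIC CORNER; PROVED, no `δ`; KINEMATIC — calibration only).**  For
every `C` there is `θ₀(C) > 0` such that a Type-I ancient mild field whose Reynolds stress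
coarse-grained at the single relative scale `θ(-t)`, `0 < θ ≤ θ₀(C)`, is EXACTLY ISOTROPIC at every
time (`e^{θ(-t)Δ}(u ⊗ u)(t) = p(t,·) I`, equivalently `D[u](t, θ(-t)) ≡ 0`) vanishes identically.
REV 2 (critic correction α): true for every `θ > 0` and every field with bounded continuous slices by
injectivity of `e^{sΔ}` on `C_b` + rank-one algebra — no dynamics; proved here through the engine. -/
def Row_A2d0 : Prop :=
  ∀ C : ℝ, ∃ θ₀ : ℝ, 0 < θ₀ ∧ ∀ θ : ℝ, 0 < θ → θ ≤ θ₀ →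
    ∀ u : ℝ → E3 → E3, IsTypeIAncientMild C u →
      (∀ t < 0, ∀ y j k, devStress u t (θ * (-t)) j k y = 0) →
        ∀ t < 0, ∀ x, u t x = 0

/-- **Row A2db (SINGLE-SCALE ISOTROPY ON A BACKWARD END; PROVED).**  As A2d1 with the
hypothesis only at sufficiently early times `t < T₀` (forward uniqueness carries the conclusion
to all `t < 0`). -/
def Row_A2db : Prop :=
  ∃ δ₀ : ℝ, 0 < δ₀ ∧ ∀ C : ℝ, ∃ θ₀ : ℝ, 0 < θ₀ ∧ ∀ θ : ℝ, 0 < θ → θ ≤ θ₀ →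
    ∀ u : ℝ → E3 → E3, IsTypeIAncientMild C u →
      (∃ T₀ < 0, ∀ t < T₀, ∀ y j k, |devStress u t (θ * (-t)) j k y| ≤ δ₀ / (-t)) →
        ∀ t < 0, ∀ x, u t x = 0

/-- **Row A2dv (THE SCALE-WEIGHTED UNIVERSAL METER; PROVED, universal thresholds).**  For every
`β ∈ [0, 1/2)` there is `δ₀(β) > 0` such that for ALL constants `C`: a Type-I ancient mild field
whose coarse-grained deviatoric stress obeys `|D[u](t,s)ⱼₖ(y)| ≤ δ₀ (-t)^{-1} (s/(-t))^{-β}` at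
all scales `0 < s < -t` vanishes identically.  For `β > 0` the weight releases the small scales
(where the bound exceeds the free value `C²/(-t)`, i.e. `s ≤ (-t)(δ₀/C²)^{1/β}`, nothing is asked);
the member `β = 0` is the THIN corner (letting `s → 0` it bounds `|u|²` itself and reduces to the
small-constant cell A2a) and is kept only as the calibration end of the family. -/
def Row_A2dv : Prop :=
  ∀ β : ℝ, 0 ≤ β → β < 1/2 → ∃ δ₀ : ℝ, 0 < δ₀ ∧ ∀ (C : ℝ) (u : ℝ → E3 → E3),
    IsTypeIAncientMild C u →
      (∀ t < 0, ∀ s : ℝ, 0 < s → s < -t → ∀ y j k,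
        |devStress u t s j k y| ≤ δ₀ * (-t) ^ (β - 1) * s ^ (-β)) →
        ∀ t < 0, ∀ x, u t x = 0

/-- **Row A2dn (ISOTROPY AT THE NATURAL SCALE, universal; OPEN).**  Is there a universal `δ₀ > 0`
such that for ALL `C`: near-isotropy of the stress coarse-grained at the parabolic scale itself,
`|D[u](t, -t)ⱼₖ(y)| ≤ δ₀/(-t)` for all `t, y`, forces `u ≡ 0`?  (Decided by A2d1 only when
`θ₀(C) ≥ 1`, i.e. for small `C`, where A2a already rules; the engine's short lags are not
controlled for large `C`.)  NOT proved here. -/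
@[conjecture] def Row_A2dn : Prop :=
  ∃ δ₀ : ℝ, 0 < δ₀ ∧ ∀ (C : ℝ) (u : ℝ → E3 → E3), IsTypeIAncientMild C u →
    (∀ t < 0, ∀ y j k, |devStress u t (-t) j k y| ≤ δ₀ / (-t)) →
      ∀ t < 0, ∀ x, u t x = 0

/-- **Row A2dl (ISOTROPY ALONG A SEQUENCE OF TIMES; OPEN).**  Single-scale isotropy as in A2d1 but
only along some sequence `tₙ → -∞`.  The window engine needs the hypothesis on whole windows;
NOT proved here (cf. the tree's far-past floor `stub_liminfFarPastLiouville`, which needs smallness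
of `u` itself). -/
@[conjecture] def Row_A2dl : Prop :=
  ∃ δ₀ : ℝ, 0 < δ₀ ∧ ∀ C : ℝ, ∃ θ₀ : ℝ, 0 < θ₀ ∧ ∀ θ : ℝ, 0 < θ → θ ≤ θ₀ →
    ∀ u : ℝ → E3 → E3, IsTypeIAncientMild C u →
      (∃ T : ℕ → ℝ, Tendsto T atTop atBot ∧
        ∀ n, T n < 0 ∧ ∀ y j k, |devStress u (T n) (θ * (-(T n))) j k y| ≤ δ₀ / (-(T n))) →
        ∀ t < 0, ∀ x, u t x = 0

/-! ## I. Proofs of the decided rows -/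

/-- **Row A2da holds.** -/
theorem row_A2da_holds : Row_A2da := by
  refine ⟨devThreshold, devThreshold_pos, fun C => ⟨scaleThreshold C, scaleThreshold_pos C,
    fun θ hθ hθC u hu hdev => ?_⟩⟩
  exact eq_zero_of_dev_above_scale hu le_rfl hθ hθC (fun τ hτ s hs y j k => hdev τ hτ s hs y j k)

/-- Single scale ⇒ all larger scales (semigroup covariance + maximum principle). -/
theorem dev_above_of_single {C : ℝ} {u : ℝ → E3 → E3} (hu : IsTypeIAncientMild C u) {θ : ℝ}
    (hθ : 0 < θ) {T₀ : ℝ} (hT₀ : T₀ ≤ 0) {ε : ℝ → ℝ}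
    (h : ∀ t < T₀, ∀ y j k, |devStress u t (θ * (-t)) j k y| ≤ ε t) :
    ∀ t < T₀, ∀ s : ℝ, θ * (-t) ≤ s → ∀ y j k, |devStress u t s j k y| ≤ ε t := by
  intro t ht s hs y j k
  have ht0 : t < 0 := lt_of_lt_of_le ht hT₀
  have hθt : 0 < θ * (-t) := mul_pos hθ (by linarith)
  exact abs_devStress_mono hu ht0 hθt hs (fun y => h t ht y j k) y

/-- **Row A2db holds.** -/
theorem row_A2db_holds : Row_A2db := by
  refine ⟨devThreshold, devThreshold_pos, fun C => ⟨scaleThreshold C, scaleThreshold_pos C,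
    fun θ hθ hθC u hu hdev => ?_⟩⟩
  obtain ⟨T₀, hT₀, h⟩ := hdev
  exact eq_zero_of_dev_above_scale hu hT₀.le hθ hθC (dev_above_of_single hu hθ hT₀.le h)

/-- **Row A2d1 holds.** -/
theorem row_A2d1_holds : Row_A2d1 := by
  refine ⟨devThreshold, devThreshold_pos, fun C => ⟨scaleThreshold C, scaleThreshold_pos C,
    fun θ hθ hθC u hu hdev => ?_⟩⟩
  exact eq_zero_of_dev_above_scale hu le_rfl hθ hθC (dev_above_of_single hu hθ le_rfl hdev)

/-- **Row A2d0 holds.** -/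
theorem row_A2d0_holds : Row_A2d0 := by
  obtain ⟨δ₀, hδ₀, H⟩ := row_A2d1_holds
  intro C
  obtain ⟨θ₀, hθ₀, Hθ⟩ := H C
  refine ⟨θ₀, hθ₀, fun θ hθ hθ₀' u hu hz => Hθ θ hθ hθ₀' u hu fun t ht y j k => ?_⟩
  rw [hz t ht y j k, abs_zero]
  exact div_nonneg hδ₀.le (by linarith)

/-- **Row A2dv holds.** -/
theorem row_A2dv_holds : Row_A2dv := by
  intro β _ hβ
  have hK := weightConst_pos hβ
  have hκ0 : 0 < 1 - 1 / Real.sqrt 2 := by linarith [one_div_sqrt_two_lt_one]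
  refine ⟨(1 - 1 / Real.sqrt 2) / (2 * weightConst β), by positivity, fun C u hu hdev => ?_⟩
  exact eq_zero_of_dev_weighted hu le_rfl hβ (fun τ hτ s hs hs' y j k => hdev τ hτ s hs hs' y j k)

/-! ## J. Nestings and controls -/

/-- Nesting: A2da implies A2d1. -/
theorem row_A2d1_of_row_A2da : Row_A2da → Row_A2d1 := by
  rintro ⟨δ₀, hδ₀, H⟩
  refine ⟨δ₀, hδ₀, fun C => ?_⟩
  obtain ⟨θ₀, hθ₀, Hθ⟩ := H C
  exact ⟨θ₀, hθ₀, fun θ hθ hθ₀' u hu hdev =>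
    Hθ θ hθ hθ₀' u hu (dev_above_of_single hu hθ le_rfl hdev)⟩

/-- The TRIVIAL nesting (REV 2, critic correction β): the single-scale row implies the all-scales row,
because the all-scales hypothesis contains the scale `s = θ(-t)`. -/
theorem row_A2da_of_row_A2d1 : Row_A2d1 → Row_A2da := by
  rintro ⟨δ₀, hδ₀, H⟩
  refine ⟨δ₀, hδ₀, fun C => ?_⟩
  obtain ⟨θ₀, hθ₀, Hθ⟩ := H C
  exact ⟨θ₀, hθ₀, fun θ hθ hθ₀' u hu hdev =>
    Hθ θ hθ hθ₀' u hu fun t ht y j k => hdev t ht (θ * (-t)) le_rfl y j k⟩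

/-- Nesting: A2db implies A2d1. -/
theorem row_A2d1_of_row_A2db : Row_A2db → Row_A2d1 := by
  rintro ⟨δ₀, hδ₀, H⟩
  refine ⟨δ₀ / 2, by positivity, fun C => ?_⟩
  obtain ⟨θ₀, hθ₀, Hθ⟩ := H C
  refine ⟨θ₀, hθ₀, fun θ hθ hθ₀' u hu hdev => Hθ θ hθ hθ₀' u hu ⟨-1, by norm_num, fun t ht y j k => ?_⟩⟩
  refine (hdev t (by linarith) y j k).trans ?_
  exact div_le_div_of_nonneg_right (by linarith) (by linarith)

/-- Nesting: A2d1 implies A2d0. -/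
theorem row_A2d0_of_row_A2d1 : Row_A2d1 → Row_A2d0 := by
  rintro ⟨δ₀, hδ₀, H⟩ C
  obtain ⟨θ₀, hθ₀, Hθ⟩ := H C
  refine ⟨θ₀, hθ₀, fun θ hθ hθ₀' u hu hz => Hθ θ hθ hθ₀' u hu fun t ht y j k => ?_⟩
  rw [hz t ht y j k, abs_zero]
  exact div_nonneg hδ₀.le (by linarith)

/-- **Calibration control: the universal meter contains a small-constant cell.**  Every member
`β` of Row A2dv implies that `A_C = {0}` for `C² ≤ δ₀(β)·(-t)^β s^{-β}`-compatible constants — in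
particular (`β = 0`) for all `C` with `C² ≤ δ₀(0)`: the free value `C²/(-t)` of the meter already
satisfies the hypothesis.  (This is the honest floor of the family: at `β = 0` the row is no
stronger in kind than census A2a.) -/
theorem smallConstant_of_row_A2dv (H : Row_A2dv) :
    ∃ c : ℝ, 0 < c ∧ ∀ (C : ℝ) (u : ℝ → E3 → E3), IsTypeIAncientMild C u → C * C ≤ c →
      ∀ t < 0, ∀ x, u t x = 0 := by
  obtain ⟨δ₀, hδ₀, H0⟩ := H 0 le_rfl (by norm_num)
  refine ⟨δ₀, hδ₀, fun C u hu hC => H0 C u hu fun t ht s hs _ y j k => ?_⟩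
  refine (abs_devStress_le_typeI hu ht hs j k y).trans ?_
  rw [Real.rpow_neg hs.le, Real.rpow_zero, inv_one, mul_one, show (0:ℝ) - 1 = -1 by norm_num,
    Real.rpow_neg_one]
  rw [div_eq_mul_inv]
  exact mul_le_mul_of_nonneg_right hC (inv_nonneg.2 (by linarith))

/-- **The free region, quantified**: for `u ∈ A_C` the weighted hypothesis of Row A2dv at scale
`s` holds AUTOMATICALLY whenever `C² (s/(-t))^β ≤ δ₀`, i.e. below the relative scale
`(δ₀/C²)^{1/β}` — the row constrains only the mesoscopic scales. -/
theorem weighted_hypothesis_free {C : ℝ} {u : ℝ → E3 → E3} (hu : IsTypeIAncientMild C u)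
    {t : ℝ} (ht : t < 0) {s β δ : ℝ} (hs : 0 < s) (hfree : C * C * (s / (-t)) ^ β ≤ δ)
    (j k : Fin 3) (y : E3) :
    |devStress u t s j k y| ≤ δ * (-t) ^ (β - 1) * s ^ (-β) := by
  have hT : 0 < -t := by linarith
  refine (abs_devStress_le_typeI hu ht hs j k y).trans ?_
  have hsb : 0 < (s / (-t)) ^ β := Real.rpow_pos_of_pos (div_pos hs hT) _
  have e : δ * (-t) ^ (β - 1) * s ^ (-β) = δ / ((s / (-t)) ^ β) / (-t) := by
    rw [Real.div_rpow hs.le hT.le, Real.rpow_sub hT, Real.rpow_one, Real.rpow_neg hs.le]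
    field_simp
  rw [e]
  refine div_le_div_of_nonneg_right ?_ hT.le
  rw [le_div_iff₀ hsb]
  exact hfree

end Summit.NavierStokesRegularity.NavierStokesRegularity.Theorems.ScenarioCensus.DeviatorMeter

namespace Summit.NavierStokesRegularity.NavierStokesRegularity.Theorems.ScenarioCensus

/-! ## Census KEYS (ns `…Theorems.ScenarioCensus`): instrument DEVIATOR METER (block A2) — TREE-decided cells A2da / A2d1 / A2d0 / A2db / A2dv, OPEN rows A2dn / A2dl -/

/-- **Cell A2da** (isotropy above a relative scale; engine row, mixed thresholds): `:= DeviatorMeter.Row_A2da`. DECIDED. -/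
def Row_A2da : Prop := DeviatorMeter.Row_A2da
/-- A2da is EXCLUDED (decided in the tree): `DeviatorMeter.row_A2da_holds`. -/
theorem row_A2da_excluded : Row_A2da := DeviatorMeter.row_A2da_holds

/-- **Cell A2d1** (single-scale isotropy; head of the decided part): `:= DeviatorMeter.Row_A2d1`. DECIDED. -/
def Row_A2d1 : Prop := DeviatorMeter.Row_A2d1
/-- A2d1 is EXCLUDED (decided in the tree): `DeviatorMeter.row_A2d1_holds`. -/
theorem row_A2d1_excluded : Row_A2d1 := DeviatorMeter.row_A2d1_holds

/-- **Cell A2d0** (the exactly isotropic corner; kinematic calibration): `:= DeviatorMeter.Row_A2d0`. DECIDED. -/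
def Row_A2d0 : Prop := DeviatorMeter.Row_A2d0
/-- A2d0 is EXCLUDED (decided in the tree): `DeviatorMeter.row_A2d0_holds`. -/
theorem row_A2d0_excluded : Row_A2d0 := DeviatorMeter.row_A2d0_holds

/-- **Cell A2db** (single-scale isotropy on a backward end): `:= DeviatorMeter.Row_A2db`. DECIDED. -/
def Row_A2db : Prop := DeviatorMeter.Row_A2db
/-- A2db is EXCLUDED (decided in the tree): `DeviatorMeter.row_A2db_holds`. -/
theorem row_A2db_excluded : Row_A2db := DeviatorMeter.row_A2db_holds

/-- **Cell A2dv** (the scale-weighted universal meter): `:= DeviatorMeter.Row_A2dv`. DECIDED. -/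
def Row_A2dv : Prop := DeviatorMeter.Row_A2dv
/-- A2dv is EXCLUDED (decided in the tree): `DeviatorMeter.row_A2dv_holds`. -/
theorem row_A2dv_excluded : Row_A2dv := DeviatorMeter.row_A2dv_holds

/-- **Row A2dn** (isotropy at the natural scale, universal) — typed only: `:= DeviatorMeter.Row_A2dn`. OPEN (no witness, no proof). -/
@[conjecture] def Row_A2dn : Prop := DeviatorMeter.Row_A2dn

/-- **Row A2dl** (isotropy along a sequence of times) — typed only: `:= DeviatorMeter.Row_A2dl`. OPEN (no witness, no proof). -/
@[conjecture] def Row_A2dl : Prop := DeviatorMeter.Row_A2dl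

/-- Lattice edges at key level: A2da → A2d1, A2db → A2d1, A2d1 → A2d0 (`DeviatorMeter.row_A2d1_of_row_A2da` / `…_of_row_A2db` / `row_A2d0_of_row_A2d1`). -/
theorem row_A2d1_of_row_A2da : Row_A2da → Row_A2d1 := DeviatorMeter.row_A2d1_of_row_A2da
/-- See `row_A2d1_of_row_A2da`. -/
theorem row_A2d1_of_row_A2db : Row_A2db → Row_A2d1 := DeviatorMeter.row_A2d1_of_row_A2db
/-- See `row_A2d1_of_row_A2da`. -/
theorem row_A2d0_of_row_A2d1 : Row_A2d1 → Row_A2d0 := DeviatorMeter.row_A2d0_of_row_A2d1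

end Summit.NavierStokesRegularity.NavierStokesRegularity.Theorems.ScenarioCensus

end
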